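import Literature.Geometry.Lorentzian.CoordCurvatureLaplacian
import HarnessLib

/-!
# Rank-generic covariant tensor calculus in coordinates (components)

Towards Shi's global derivative estimates (Topping 2006, Thm. 3.3.1) for all orders `k`, which the
proof of the curvature blow-up theorem (Topping 2006, Thm. 5.3.1; the CLAIM of pp. 46–47) needs,
this file sets up a **rank-generic** coordinate tensor calculus. The datum is, as in
`CoordCurvature.lean`, a field of bilinear forms `G : E → (E →L E →L ℝ)` (the components of a
metric in a chart, `IsMetricOn G V`) together with a basis `b` of `E`. A covariant tensor field of
index type `α` (a finite type; rank `= card α`) is represented by its **components**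
`T : E → (α → ι) → ℝ`, `T x I = T_x(b_{I a₁}, …, b_{I a_r})`.

* `chrCoef G b x j i m = Γ^m_{ji}(x)` — Christoffel symbols in the basis;
* `tcov G b T : E → (Option α → ι) → ℝ` — the **covariant derivative**
  `(∇T)_{j I} = ∂_j T_I − Σ_a Σ_m Γ^m_{j I_a} T_{I[a ↦ m]}` (the new slot is `none`);
* `tprod S T` (tensor product, index type `α ⊕ β`), `treindex e T` (relabelling of slots along
  `e : α ≃ β`), `ttr G b T` (the metric trace `g^{jk} T_{j k I}` of the two outermost `Option`
  slots), `tinner G b S T` / `tnormSq G b T` (the full contraction `⟨S, T⟩_g`, `|T|²_g`),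
  `pcontr G b S T` (contraction of `S_{k I}` with `T_J` over `I, J`, one free slot), and the rough
  Laplacian `tlap G b T = ttr (tcov (tcov T))`, `(ΔT)_I = g^{jk} (∇∇T)_{j k I}`.

Proved: smoothness of all of these on `V`; the Leibniz rule `∇(S ⊗ T) = ∇S ⊗ T + S ⊗ ∇T`
(`tcov_tprod`); `∇` commutes with relabelling (`tcov_treindex`); **`∇` commutes with the metric
trace** (`tcov_ttr`, i.e. `∇g⁻¹ = 0`); and **metric compatibility of the contraction**,
`∂_j ⟨S_{k·}, T⟩ = ⟨(∇_j S)_{k·}, T⟩ + ⟨S_{k·}, ∇_j T⟩ + Γ^m_{jk} ⟨S_{m·}, T⟩` (`fderiv_pcontr`) with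
its scalar case `∂_j ⟨S, T⟩ = ⟨∇_j S, T⟩ + ⟨S, ∇_j T⟩` (`fderiv_tinner`, `fderiv_tnormSq`). These are
O'Neill 1983, Ch. 2, Prop. 2.13 / Ch. 3, Prop. 3.13 ff. (tensor derivations, `∇` commutes with
contractions) written in a basis; Topping 2006, §2.1 (conventions `∇`, `Δ = tr ∇²`, `⟨·,·⟩`).
Everything is proved; no definition of `Prop` type.

## References

* B. O'Neill, *Semi-Riemannian geometry with applications to relativity*, Academic Press 1983,
  Ch. 2, Def. 2.9–Prop. 2.13 (tensor derivations and contraction), Ch. 3, Prop. 3.13, p. 86.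
  [ONeill1983]
* P. Topping, *Lectures on the Ricci flow*, LMS Lecture Note Series 325, CUP 2006, §2.1, §3.3.
  [Topping2006]
-/

noncomputable section

set_option maxSynthPendingDepth 3

open Set Filter ContinuousLinearMap Module Function
open scoped Topology ContDiff

namespace Literature.Geometry.Lorentzian

namespace MetricCoord

/-! ### Index bookkeeping -/

section Indices

variable {ι : Type*} {α β : Type*}

/-- Prepend an index: `ocons j I : Option α → ι` sends `none ↦ j`, `some a ↦ I a`. [folklore] -/
def ocons (j : ι) (I : α → ι) : Option α → ι := fun o ↦ o.elim j I

/-- `ocons j I none = j`. [folklore] -/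
@[simp] theorem ocons_none (j : ι) (I : α → ι) : ocons j I none = j := rfl

/-- `ocons j I (some a) = I a`. [folklore] -/
@[simp] theorem ocons_some (j : ι) (I : α → ι) (a : α) : ocons j I (some a) = I a := rfl

/-- `ocons j I ∘ some = I`. [folklore] -/
@[simp] theorem ocons_comp_some (j : ι) (I : α → ι) : ocons j I ∘ some = I := rfl

/-- Every index function on `Option α` is an `ocons`. [folklore] -/
theorem ocons_eta (J : Option α → ι) : ocons (J none) (J ∘ some) = J := by
  funext o; cases o <;> rfl

/-- Updating the prepended slot. [folklore] -/
@[simp] theorem update_ocons_none [DecidableEq α] (j m : ι) (I : α → ι) :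
    update (ocons j I) none m = ocons m I := by
  funext o; cases o <;> simp

/-- Updating an original slot commutes with prepending. [folklore] -/
@[simp] theorem update_ocons_some [DecidableEq α] (j m : ι) (I : α → ι) (a : α) :
    update (ocons j I) (some a) m = ocons j (update I a m) := by
  funext o
  cases o with
  | none => simp
  | some a' =>
    by_cases h : a' = a
    · subst h; simp
    · simp [h]

/-- Relabelling commutes with `ocons`. [folklore] -/
theorem ocons_comp_optionCongr (e : α ≃ β) (j : ι) (I : β → ι) :
    ocons j I ∘ (e.optionCongr : Option α ≃ Option β) = ocons j (I ∘ e) := by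
  funext o; cases o <;> rfl

/-- **Re-summation after an update**: `Σ_J Σ_m F(J, m) = Σ_J Σ_c F(J[a ↦ c], J a)` (the map
`(J, m) ↦ (J[a ↦ m], J a)` is an involution of `(α → ι) × ι`). [folklore] -/
theorem sum_sum_update_swap [Fintype ι] [Fintype α] [DecidableEq α] {R : Type*} [AddCommMonoid R]
    (F : (α → ι) → ι → R) (a : α) :
    ∑ J : α → ι, ∑ m : ι, F J m = ∑ J : α → ι, ∑ c : ι, F (update J a c) (J a) := by
  set φ : (α → ι) × ι → (α → ι) × ι := fun p ↦ (update p.1 a p.2, p.1 a) with hφ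
  have hinv : Function.Involutive φ := by
    intro p
    simp only [hφ, update_idem, update_self, update_eq_self]
  rw [← Finset.sum_product' (f := fun J m ↦ F J m), ← Finset.sum_product'
    (f := fun J c ↦ F (update J a c) (J a))]
  simp only [Finset.univ_product_univ]
  exact (Fintype.sum_bijective φ hinv.bijective _ _ fun p ↦ rfl).symm

end Indices

/-! ### Tensor product and relabelling (no metric needed) -/

section Pure

variable {E : Type*} {ι : Type*} {α β γ : Type*}

/-- Tensor product of components, `(S ⊗ T)_{(I, J)} = S_I T_J`. [cite: ONeill1983, Ch. 2, Def. 2.4] -/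
def tprod (S : E → (α → ι) → ℝ) (T : E → (β → ι) → ℝ) : E → (α ⊕ β → ι) → ℝ :=
  fun x K ↦ S x (K ∘ Sum.inl) * T x (K ∘ Sum.inr)

/-- Relabelling of the slots along `e : α ≃ β`: `(treindex e T)_J = T_{J ∘ e}`. [folklore] -/
def treindex (e : α ≃ β) (T : E → (α → ι) → ℝ) : E → (β → ι) → ℝ :=
  fun x J ↦ T x (J ∘ e)

/-- Unfolding lemma for `tprod`. [folklore] -/
@[simp] theorem tprod_apply (S : E → (α → ι) → ℝ) (T : E → (β → ι) → ℝ) (x : E) (K : α ⊕ β → ι) :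
    tprod S T x K = S x (K ∘ Sum.inl) * T x (K ∘ Sum.inr) := rfl

/-- Unfolding lemma for `treindex`. [folklore] -/
@[simp] theorem treindex_apply (e : α ≃ β) (T : E → (α → ι) → ℝ) (x : E) (J : β → ι) :
    treindex e T x J = T x (J ∘ e) := rfl

/-- Relabelling is functorial. [folklore] -/
theorem treindex_treindex (e : α ≃ β) (e' : β ≃ γ) (T : E → (α → ι) → ℝ) :
    treindex e' (treindex e T) = treindex (e.trans e') T := by
  funext x J; rfl

/-- Relabelling along the identity. [folklore] -/
@[simp] theorem treindex_refl (T : E → (α → ι) → ℝ) : treindex (Equiv.refl α) T = T := rfl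

/-- Relabelling is additive. [folklore] -/
theorem treindex_add (e : α ≃ β) (S T : E → (α → ι) → ℝ) :
    treindex e (S + T) = treindex e S + treindex e T := rfl

/-- Relabelling commutes with subtraction. [folklore] -/
theorem treindex_sub (e : α ≃ β) (S T : E → (α → ι) → ℝ) :
    treindex e (S - T) = treindex e S - treindex e T := rfl

/-- Relabelling commutes with scalar multiplication. [folklore] -/
theorem treindex_smul (e : α ≃ β) (c : ℝ) (T : E → (α → ι) → ℝ) :
    treindex e (c • T) = c • treindex e T := rfl

/-- Relabelling commutes with negation. [folklore] -/
theorem treindex_neg (e : α ≃ β) (T : E → (α → ι) → ℝ) : treindex e (-T) = -treindex e T := rfl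

/-- A sum over index functions on `Option (Option α)` relabelled along `e` in the inner slots.
[folklore] -/
theorem sum_mul_treindex_ocons [Fintype ι] (e : α ≃ β) (T : E → (Option (Option α) → ι) → ℝ)
    (x : E) (J : β → ι) (g : ι → ι → ℝ) :
    ∑ j, ∑ k, g j k * T x (ocons j (ocons k (J ∘ e))) =
      ∑ j, ∑ k, g j k * treindex (e.optionCongr.optionCongr) T x (ocons j (ocons k J)) := by
  refine Finset.sum_congr rfl fun j _ ↦ Finset.sum_congr rfl fun k _ ↦ ?_
  rw [treindex_apply]
  congr 2
  funext o; rcases o with _ | _ | a <;> rfl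

end Pure

/-! ### The metric objects -/

variable {E : Type*} [NormedAddCommGroup E] [NormedSpace ℝ E] {ι : Type*}

section ChrCoef

variable (G : E → E →L[ℝ] E →L[ℝ] ℝ) (b : Basis ι ℝ E)

/-- **Christoffel symbols in the basis**: `Γ^m_{ji}(x) = bᵐ(Γ_x(b_j, b_i))`.
[cite: ONeill1983, Ch. 3, Prop. 3.13] -/
def chrCoef (x : E) (j i m : ι) : ℝ :=
  b.coord m (chrAt G x (b j) (b i))

variable {G} {V : Set E} {x : E}

/-- `Γ(b_j, b_i) = Σ_m Γ^m_{ji} b_m`. [cite: ONeill1983, Ch. 3, Prop. 3.13] -/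
theorem chrAt_basis_eq_sum [Fintype ι] (x : E) (j i : ι) :
    chrAt G x (b j) (b i) = ∑ m, chrCoef G b x j i m • b m := by
  conv_lhs => rw [← b.sum_repr (chrAt G x (b j) (b i))]
  rfl

/-- `Γ^m_{ji} = Γ^m_{ij}` (torsion-freeness). [cite: ONeill1983, Ch. 3, Prop. 3.13] -/
theorem IsMetricOn.chrCoef_comm [CompleteSpace E] (hG : IsMetricOn G V) (hx : x ∈ V) (j i m : ι) :
    chrCoef G b x j i m = chrCoef G b x i j m := by
  unfold chrCoef; rw [hG.chrAt_comm hx]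

/-- The Christoffel symbols are `C^∞` on `V`. [folklore] -/
theorem IsMetricOn.contDiffOn_chrCoef [CompleteSpace E] [FiniteDimensional ℝ E] (hG : IsMetricOn G V)
    (j i m : ι) : ContDiffOn ℝ ∞ (fun x ↦ chrCoef G b x j i m) V := by
  have h : ContDiffOn ℝ ∞ (fun x ↦ chrAt G x (b j) (b i)) V :=
    ((hG.contDiffOn_chrAt).clm_apply contDiffOn_const).clm_apply contDiffOn_const
  have h2 := (coordCLM b m).contDiff.comp_contDiffOn h
  exact h2

/-- The Christoffel symbols are differentiable at the points of `V`. [folklore] -/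
theorem IsMetricOn.differentiableAt_chrCoef [CompleteSpace E] [FiniteDimensional ℝ E]
    (hG : IsMetricOn G V) (hx : x ∈ V) (j i m : ι) :
    DifferentiableAt ℝ (fun x ↦ chrCoef G b x j i m) x :=
  ((hG.contDiffOn_chrCoef b j i m).contDiffAt (hG.isOpen.mem_nhds hx)).differentiableAt (by simp)

/-- `bᵏ(Γ(b_j, b_c)) = Σ_d g^{kd} G(Γ(b_j,b_c), b_d)`. [folklore] -/
theorem chrCoef_eq_sum_ginv [Fintype ι] [FiniteDimensional ℝ E] (hx : (G x).IsInvertible)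
    (j c k : ι) :
    chrCoef G b x j c k = ∑ d, ginv G b x k d * G x (chrAt G x (b j) (b c)) (b d) :=
  coord_eq_sum_ginv b hx _ _

/-- **Derivative of the inverse metric through the Christoffel symbols**:
`∂_j g^{ik} = −Σ_c g^{ic} Γ^k_{jc} − Σ_d Γ^i_{jd} g^{dk}`. [cite: ONeill1983, Ch. 3, p. 86] -/
theorem IsMetricOn.fderiv_ginv_eq_chrCoef [Fintype ι] [CompleteSpace E] [FiniteDimensional ℝ E]
    (hG : IsMetricOn G V) (hx : x ∈ V) (i k j : ι) :
    fderiv ℝ (fun y ↦ ginv G b y i k) x (b j) =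
      -(∑ c, ginv G b x i c * chrCoef G b x j c k) - ∑ d, chrCoef G b x j d i * ginv G b x d k := by
  have hi := hG.isInvertible x hx
  have hs := hG.symm x hx
  have hgs : ∀ p q, ginv G b x p q = ginv G b x q p := fun p q ↦ ginv_comm b hi hs p q
  rw [hG.fderiv_ginv b hx i k (b j)]
  have hsplit : ∀ c d, ginv G b x i c * fderiv ℝ G x (b j) (b c) (b d) * ginv G b x d k =
      ginv G b x i c * (ginv G b x k d * G x (chrAt G x (b j) (b c)) (b d))
        + (ginv G b x i c * G x (chrAt G x (b j) (b d)) (b c)) * ginv G b x d k := by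
    intro c d
    rw [hG.fderiv_eq_chrAt hx (b j) (b c) (b d), hs (b c) (chrAt G x (b j) (b d)), hgs d k]
    ring
  simp only [hsplit, Finset.sum_add_distrib]
  rw [neg_add, ← sub_eq_add_neg]
  congr 1
  · congr 1
    refine Finset.sum_congr rfl fun c _ ↦ ?_
    rw [← Finset.mul_sum, chrCoef_eq_sum_ginv b hi j c k]
  · rw [Finset.sum_comm]
    refine Finset.sum_congr rfl fun d _ ↦ ?_
    rw [chrCoef_eq_sum_ginv b hi j d i, Finset.sum_mul]

end ChrCoef

section Defs

variable [Fintype ι] (G : E → E →L[ℝ] E →L[ℝ] ℝ) (b : Basis ι ℝ E) {α β : Type*}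

/-- **Covariant derivative of a covariant tensor field in components**:
`(∇T)_{j I} = ∂_j T_I − Σ_a Σ_m Γ^m_{j I_a} T_{I[a ↦ m]}` (O'Neill 1983, Ch. 2, Prop. 2.13; the
differentiation slot is `none`). [cite: ONeill1983, Ch. 2, Prop. 2.13] -/
def tcov [Fintype α] [DecidableEq α] (T : E → (α → ι) → ℝ) : E → (Option α → ι) → ℝ :=
  fun x J ↦ fderiv ℝ (fun y ↦ T y (J ∘ some)) x (b (J none))
    - ∑ a, ∑ m, chrCoef G b x (J none) (J (some a)) m * T x (update (J ∘ some) a m)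

variable [FiniteDimensional ℝ E]

/-- **Metric trace of the two outermost slots**: `(tr T)_I = Σ_{jk} g^{jk} T_{j k I}`.
[cite: ONeill1983, Ch. 3, pp. 60–61] -/
def ttr (T : E → (Option (Option α) → ι) → ℝ) : E → (α → ι) → ℝ :=
  fun x I ↦ ∑ j, ∑ k, ginv G b x j k * T x (ocons j (ocons k I))

/-- **Full contraction** `⟨S, T⟩_g = Σ_{I,J} (Π_a g^{I_a J_a}) S_I T_J`. [cite: Topping2006, §2.1] -/
def tinner [Fintype α] [DecidableEq α] (S T : E → (α → ι) → ℝ) (x : E) : ℝ :=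
  ∑ I : α → ι, ∑ J : α → ι, (∏ a, ginv G b x (I a) (J a)) * (S x I * T x J)

/-- `|T|²_g = ⟨T, T⟩_g`. [cite: Topping2006, §2.1] -/
def tnormSq [Fintype α] [DecidableEq α] (T : E → (α → ι) → ℝ) (x : E) : ℝ :=
  tinner G b T T x

/-- **Partial contraction with one free slot**: `(pcontr S T)_k = Σ_{I,J} (Π_a g^{I_a J_a}) S_{k I} T_J`
(e.g. `⟨∇_k T, T⟩`). [cite: Topping2006, §2.1] -/
def pcontr [Fintype α] [DecidableEq α] (S : E → (Option α → ι) → ℝ) (T : E → (α → ι) → ℝ)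
    (x : E) (k : ι) : ℝ :=
  ∑ I : α → ι, ∑ J : α → ι, (∏ a, ginv G b x (I a) (J a)) * (S x (ocons k I) * T x J)

/-- **Rough Laplacian** `(ΔT)_I = Σ_{jk} g^{jk} (∇∇T)_{j k I}` (Topping 2006, §2.1, `Δ = tr ∇²`).
[cite: Topping2006, §2.1] -/
def tlap [Fintype α] [DecidableEq α] (T : E → (α → ι) → ℝ) : E → (α → ι) → ℝ :=
  ttr G b (tcov G b (tcov G b T))

end Defs

/-- Componentwise smoothness of a tensor field on `V`. [folklore] -/
def TSmoothOn {α : Type*} (T : E → (α → ι) → ℝ) (V : Set E) : Prop :=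
  ∀ I, ContDiffOn ℝ ∞ (fun x ↦ T x I) V

/-! ### Unfolding lemmas and algebra -/

section Algebra

variable [Fintype ι] {G : E → E →L[ℝ] E →L[ℝ] ℝ} {b : Basis ι ℝ E} {α β γ : Type*} {x : E}

/-- Unfolding lemma for `tcov`. [cite: ONeill1983, Ch. 2, Prop. 2.13] -/
theorem tcov_apply [Fintype α] [DecidableEq α] (T : E → (α → ι) → ℝ) (x : E) (J : Option α → ι) :
    tcov G b T x J = fderiv ℝ (fun y ↦ T y (J ∘ some)) x (b (J none))
      - ∑ a, ∑ m, chrCoef G b x (J none) (J (some a)) m * T x (update (J ∘ some) a m) := rfl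

/-- Unfolding lemma for `tcov` at a prepended index: `(∇T)_{jI} = ∂_j T_I − Σ_a Σ_m Γ^m_{jI_a} T_{I[a↦m]}`. [cite: ONeill1983, Ch. 2, Prop. 2.13] -/
theorem tcov_apply_ocons [Fintype α] [DecidableEq α] (T : E → (α → ι) → ℝ) (x : E) (j : ι)
    (I : α → ι) :
    tcov G b T x (ocons j I) = fderiv ℝ (fun y ↦ T y I) x (b j)
      - ∑ a, ∑ m, chrCoef G b x j (I a) m * T x (update I a m) := rfl

/-- `∇` commutes with relabelling of the slots: `∇(treindex e T) = treindex e⁺ (∇T)`.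
[cite: ONeill1983, Ch. 2, Prop. 2.13] -/
theorem tcov_treindex [Fintype α] [DecidableEq α] [Fintype β] [DecidableEq β] (e : α ≃ β)
    (T : E → (α → ι) → ℝ) :
    tcov G b (treindex e T) = treindex e.optionCongr (tcov G b T) := by
  funext x J
  simp only [tcov_apply, treindex_apply]
  have h1 : (J ∘ ⇑(e.optionCongr)) ∘ some = J ∘ some ∘ e := by
    funext a; rfl
  have h2 : (J ∘ ⇑(e.optionCongr)) none = J none := rfl
  rw [h1, h2]
  congr 1
  rw [← e.sum_comp]
  refine Finset.sum_congr rfl fun a _ ↦ Finset.sum_congr rfl fun m _ ↦ ?_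
  have h3 : (J ∘ ⇑(e.optionCongr)) (some a) = J (some (e a)) := rfl
  rw [h3]
  congr 2
  rw [Function.update_comp_equiv (J ∘ some) e (e a) m, Equiv.symm_apply_apply]
  rfl

variable [FiniteDimensional ℝ E]

/-- Unfolding lemma for `ttr`. [cite: ONeill1983, Ch. 3, pp. 60–61] -/
theorem ttr_apply (T : E → (Option (Option α) → ι) → ℝ) (x : E) (I : α → ι) :
    ttr G b T x I = ∑ j, ∑ k, ginv G b x j k * T x (ocons j (ocons k I)) := rfl

/-- Unfolding lemma for `tlap`: `(ΔT)_I = Σ_{jk} g^{jk} (∇∇T)_{jkI}`. [cite: Topping2006, §2.1] -/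
theorem tlap_apply [Fintype α] [DecidableEq α] (T : E → (α → ι) → ℝ) (x : E) (I : α → ι) :
    tlap G b T x I = ∑ j, ∑ k, ginv G b x j k * tcov G b (tcov G b T) x (ocons j (ocons k I)) := rfl

/-- Unfolding lemma for `tinner`. [cite: Topping2006, §2.1] -/
theorem tinner_apply [Fintype α] [DecidableEq α] (S T : E → (α → ι) → ℝ) (x : E) :
    tinner G b S T x = ∑ I : α → ι, ∑ J : α → ι, (∏ a, ginv G b x (I a) (J a)) * (S x I * T x J) :=
  rfl

/-- Unfolding lemma for `pcontr`. [cite: Topping2006, §2.1] -/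
theorem pcontr_apply [Fintype α] [DecidableEq α] (S : E → (Option α → ι) → ℝ) (T : E → (α → ι) → ℝ)
    (x : E) (k : ι) :
    pcontr G b S T x k = ∑ I : α → ι, ∑ J : α → ι, (∏ a, ginv G b x (I a) (J a)) *
      (S x (ocons k I) * T x J) := rfl

/-- `|T|² = ⟨T, T⟩`. [cite: Topping2006, §2.1] -/
theorem tnormSq_eq [Fintype α] [DecidableEq α] (T : E → (α → ι) → ℝ) (x : E) :
    tnormSq G b T x = tinner G b T T x := rfl

/-- The inner product of components is symmetric when `g^{ij}` is. [folklore] -/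
theorem tinner_comm [Fintype α] [DecidableEq α] (hg : ∀ i j, ginv G b x i j = ginv G b x j i)
    (S T : E → (α → ι) → ℝ) : tinner G b S T x = tinner G b T S x := by
  unfold tinner
  rw [Finset.sum_comm]
  refine Finset.sum_congr rfl fun J _ ↦ Finset.sum_congr rfl fun I _ ↦ ?_
  rw [mul_comm (S x I)]
  congr 1
  exact Finset.prod_congr rfl fun a _ ↦ hg _ _

/-- `⟨·,·⟩` is additive on the left. [folklore] -/
theorem tinner_add_left [Fintype α] [DecidableEq α] (S S' T : E → (α → ι) → ℝ) :
    tinner G b (S + S') T x = tinner G b S T x + tinner G b S' T x := by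
  simp only [tinner, Pi.add_apply, add_mul, mul_add, Finset.sum_add_distrib]

/-- `⟨·,·⟩` is additive on the right. [folklore] -/
theorem tinner_add_right [Fintype α] [DecidableEq α] (S T T' : E → (α → ι) → ℝ) :
    tinner G b S (T + T') x = tinner G b S T x + tinner G b S T' x := by
  simp only [tinner, Pi.add_apply, mul_add, Finset.sum_add_distrib]

/-- `⟨·,·⟩` is homogeneous on the left. [folklore] -/
theorem tinner_smul_left [Fintype α] [DecidableEq α] (c : ℝ) (S T : E → (α → ι) → ℝ) :
    tinner G b (c • S) T x = c * tinner G b S T x := by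
  simp only [tinner, Pi.smul_apply, smul_eq_mul, Finset.mul_sum]
  exact Finset.sum_congr rfl fun I _ ↦ Finset.sum_congr rfl fun J _ ↦ by ring

/-- `⟨·,·⟩` is homogeneous on the right. [folklore] -/
theorem tinner_smul_right [Fintype α] [DecidableEq α] (c : ℝ) (S T : E → (α → ι) → ℝ) :
    tinner G b S (c • T) x = c * tinner G b S T x := by
  simp only [tinner, Pi.smul_apply, smul_eq_mul, Finset.mul_sum]
  exact Finset.sum_congr rfl fun I _ ↦ Finset.sum_congr rfl fun J _ ↦ by ring

/-- `⟨·,·⟩` commutes with subtraction on the left. [folklore] -/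
theorem tinner_sub_left [Fintype α] [DecidableEq α] (S S' T : E → (α → ι) → ℝ) :
    tinner G b (S - S') T x = tinner G b S T x - tinner G b S' T x := by
  simp only [tinner, Pi.sub_apply, sub_mul, mul_sub, Finset.sum_sub_distrib]

/-- `⟨·,·⟩` commutes with subtraction on the right. [folklore] -/
theorem tinner_sub_right [Fintype α] [DecidableEq α] (S T T' : E → (α → ι) → ℝ) :
    tinner G b S (T - T') x = tinner G b S T x - tinner G b S T' x := by
  simp only [tinner, Pi.sub_apply, mul_sub, Finset.sum_sub_distrib]

/-- `⟨·,·⟩` commutes with negation on the left. [folklore] -/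
theorem tinner_neg_left [Fintype α] [DecidableEq α] (S T : E → (α → ι) → ℝ) :
    tinner G b (-S) T x = -tinner G b S T x := by
  simp only [tinner, Pi.neg_apply, neg_mul, mul_neg, Finset.sum_neg_distrib]

/-- `⟨·,·⟩` commutes with negation on the right. [folklore] -/
theorem tinner_neg_right [Fintype α] [DecidableEq α] (S T : E → (α → ι) → ℝ) :
    tinner G b S (-T) x = -tinner G b S T x := by
  simp only [tinner, Pi.neg_apply, mul_neg, Finset.sum_neg_distrib]

/-- `⟨S, T⟩` through the partial contraction: `⟨S, T⟩ = pcontr S' T k` for `S'_{kI} = S_I`. [folklore] -/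
theorem pcontr_const_slot [Fintype α] [DecidableEq α] (S T : E → (α → ι) → ℝ) (k : ι) :
    pcontr G b (fun y J ↦ S y (J ∘ some)) T x k = tinner G b S T x := rfl

/-- **Relabelling preserves the inner product.** [folklore] -/
theorem tinner_treindex [Fintype α] [DecidableEq α] [Fintype β] [DecidableEq β] (e : α ≃ β)
    (S T : E → (α → ι) → ℝ) :
    tinner G b (treindex e S) (treindex e T) x = tinner G b S T x := by
  simp only [tinner, treindex_apply]
  have hE : ∀ F : (α → ι) → (α → ι) → ℝ,
      ∑ I : β → ι, ∑ J : β → ι, F (I ∘ e) (J ∘ e) = ∑ I : α → ι, ∑ J : α → ι, F I J := by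
    intro F
    rw [← (e.arrowCongr (Equiv.refl ι)).symm.sum_comp]
    refine Finset.sum_congr rfl fun I _ ↦ ?_
    rw [← (e.arrowCongr (Equiv.refl ι)).symm.sum_comp]
    rfl
  rw [← hE]
  refine Finset.sum_congr rfl fun I _ ↦ Finset.sum_congr rfl fun J _ ↦ ?_
  congr 1
  rw [← e.prod_comp]
  rfl

/-- **Relabelling preserves `|T|²`.** [folklore] -/
theorem tnormSq_treindex [Fintype α] [DecidableEq α] [Fintype β] [DecidableEq β] (e : α ≃ β)
    (T : E → (α → ι) → ℝ) : tnormSq G b (treindex e T) x = tnormSq G b T x :=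
  tinner_treindex e T T

/-- The trace is linear. [folklore] -/
theorem ttr_add (S T : E → (Option (Option α) → ι) → ℝ) :
    ttr G b (S + T) = ttr G b S + ttr G b T := by
  funext x I
  simp only [ttr, Pi.add_apply, mul_add, Finset.sum_add_distrib]

/-- The trace commutes with subtraction. [folklore] -/
theorem ttr_sub (S T : E → (Option (Option α) → ι) → ℝ) :
    ttr G b (S - T) = ttr G b S - ttr G b T := by
  funext x I
  simp only [ttr, Pi.sub_apply, mul_sub, Finset.sum_sub_distrib]

/-- The trace commutes with negation. [folklore] -/
theorem ttr_neg (T : E → (Option (Option α) → ι) → ℝ) : ttr G b (-T) = -ttr G b T := by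
  funext x I
  simp only [ttr, Pi.neg_apply, mul_neg, Finset.sum_neg_distrib]

/-- The trace commutes with scalar multiplication. [folklore] -/
theorem ttr_smul (c : ℝ) (T : E → (Option (Option α) → ι) → ℝ) :
    ttr G b (c • T) = c • ttr G b T := by
  funext x I
  simp only [ttr, Pi.smul_apply, smul_eq_mul, Finset.mul_sum]
  exact Finset.sum_congr rfl fun j _ ↦ Finset.sum_congr rfl fun k _ ↦ by ring

/-- Relabelling the untouched slots commutes with the trace. [folklore] -/
theorem treindex_ttr (e : α ≃ β) (T : E → (Option (Option α) → ι) → ℝ) :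
    treindex e (ttr G b T) = ttr G b (treindex (e.optionCongr.optionCongr) T) := by
  funext x J
  exact sum_mul_treindex_ocons e T x J (ginv G b x)

/-- Pointwise equality on `V` passes to the trace. [folklore] -/
theorem ttr_congr {V : Set E} {S T : E → (Option (Option α) → ι) → ℝ}
    (h : ∀ y ∈ V, ∀ J, S y J = T y J) : ∀ y ∈ V, ∀ I, ttr G b S y I = ttr G b T y I := by
  intro y hy I
  simp only [ttr_apply, h y hy]

end Algebra

/-! ### Smoothness -/

section Smooth

variable [Fintype ι] {G : E → E →L[ℝ] E →L[ℝ] ℝ} {b : Basis ι ℝ E} {α β : Type*} {V : Set E} {x : E}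

omit [Fintype ι] in
/-- Components of a smooth tensor field are differentiable at interior points. [folklore] -/
theorem TSmoothOn.differentiableAt {T : E → (α → ι) → ℝ} (hT : TSmoothOn T V) (hV : IsOpen V)
    (hx : x ∈ V) (I : α → ι) : DifferentiableAt ℝ (fun y ↦ T y I) x :=
  ((hT I).contDiffAt (hV.mem_nhds hx)).differentiableAt (by simp)

omit [Fintype ι] in
/-- Directional derivatives of the components are `C^∞` on the open set. [folklore] -/
theorem TSmoothOn.contDiffOn_fderiv_apply {T : E → (α → ι) → ℝ} (hT : TSmoothOn T V)
    (hV : IsOpen V) (I : α → ι) (v : E) :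
    ContDiffOn ℝ ∞ (fun y ↦ fderiv ℝ (fun z ↦ T z I) y v) V :=
  ((hT I).fderiv_of_isOpen hV (by simp)).clm_apply contDiffOn_const

omit [Fintype ι] in
/-- Smoothness on a smaller set. [folklore] -/
theorem TSmoothOn.mono {T : E → (α → ι) → ℝ} {V' : Set E} (hT : TSmoothOn T V) (h : V' ⊆ V) :
    TSmoothOn T V' :=
  fun I ↦ (hT I).mono h

/-- `∇T` is `C^∞` on `V` when `T` is. [folklore] -/
theorem IsMetricOn.tsmoothOn_tcov [CompleteSpace E] [FiniteDimensional ℝ E] [Fintype α] [DecidableEq α]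
    (hG : IsMetricOn G V) {T : E → (α → ι) → ℝ} (hT : TSmoothOn T V) : TSmoothOn (tcov G b T) V := by
  intro J
  simp only [tcov_apply]
  refine (hT.contDiffOn_fderiv_apply hG.isOpen _ _).sub ?_
  refine ContDiffOn.sum fun a _ ↦ ContDiffOn.sum fun m _ ↦ ?_
  exact (hG.contDiffOn_chrCoef b _ _ _).mul (hT _)

omit [Fintype ι] in
/-- The tensor product of smooth fields is smooth. [folklore] -/
theorem TSmoothOn.tprod {S : E → (α → ι) → ℝ} {T : E → (β → ι) → ℝ} (hS : TSmoothOn S V)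
    (hT : TSmoothOn T V) : TSmoothOn (tprod S T) V :=
  fun _ ↦ (hS _).mul (hT _)

omit [Fintype ι] in
/-- Relabelling preserves smoothness. [folklore] -/
theorem TSmoothOn.treindex (e : α ≃ β) {T : E → (α → ι) → ℝ} (hT : TSmoothOn T V) :
    TSmoothOn (treindex e T) V :=
  fun _ ↦ hT _

omit [Fintype ι] in
/-- Sums of smooth fields are smooth. [folklore] -/
theorem TSmoothOn.add {S T : E → (α → ι) → ℝ} (hS : TSmoothOn S V) (hT : TSmoothOn T V) :
    TSmoothOn (S + T) V :=
  fun I ↦ (hS I).add (hT I)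

omit [Fintype ι] in
/-- Differences of smooth fields are smooth. [folklore] -/
theorem TSmoothOn.sub {S T : E → (α → ι) → ℝ} (hS : TSmoothOn S V) (hT : TSmoothOn T V) :
    TSmoothOn (S - T) V :=
  fun I ↦ (hS I).sub (hT I)

omit [Fintype ι] in
/-- Scalar multiples of smooth fields are smooth. [folklore] -/
theorem TSmoothOn.smul (c : ℝ) {T : E → (α → ι) → ℝ} (hT : TSmoothOn T V) :
    TSmoothOn (c • T) V :=
  fun I ↦ contDiffOn_const.mul (hT I)

omit [Fintype ι] in
/-- Negatives of smooth fields are smooth. [folklore] -/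
theorem TSmoothOn.neg {T : E → (α → ι) → ℝ} (hT : TSmoothOn T V) : TSmoothOn (-T) V :=
  fun I ↦ (hT I).neg

omit [Fintype ι] in
/-- The zero field is smooth. [folklore] -/
theorem tsmoothOn_zero : TSmoothOn (0 : E → (α → ι) → ℝ) V :=
  fun _ ↦ contDiffOn_const

omit [Fintype ι] in
/-- Smoothness passes to a field with the same components on `V`. [folklore] -/
theorem TSmoothOn.congr {S T : E → (α → ι) → ℝ} (hS : TSmoothOn S V)
    (h : ∀ y ∈ V, ∀ I, T y I = S y I) : TSmoothOn T V :=
  fun I ↦ (hS I).congr fun y hy ↦ h y hy I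

variable [FiniteDimensional ℝ E]

/-- The trace of a smooth field is smooth on `V`. [folklore] -/
theorem IsMetricOn.tsmoothOn_ttr (hG : IsMetricOn G V) {T : E → (Option (Option α) → ι) → ℝ}
    (hT : TSmoothOn T V) : TSmoothOn (ttr G b T) V := by
  intro I
  simp only [ttr_apply]
  exact ContDiffOn.sum fun j _ ↦ ContDiffOn.sum fun k _ ↦ (hG.contDiffOn_ginv b j k).mul (hT _)

/-- The Laplacian of a smooth field is smooth on `V`. [folklore] -/
theorem IsMetricOn.tsmoothOn_tlap [CompleteSpace E] [Fintype α] [DecidableEq α] (hG : IsMetricOn G V)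
    {T : E → (α → ι) → ℝ} (hT : TSmoothOn T V) : TSmoothOn (tlap G b T) V :=
  hG.tsmoothOn_ttr (hG.tsmoothOn_tcov (hG.tsmoothOn_tcov hT))

/-- `y ↦ Π_a g^{I_a J_a}(y)` is `C^∞` on `V`. [folklore] -/
theorem IsMetricOn.contDiffOn_prod_ginv [Fintype α] (hG : IsMetricOn G V) (I J : α → ι) :
    ContDiffOn ℝ ∞ (fun y ↦ ∏ a, ginv G b y (I a) (J a)) V :=
  contDiffOn_prod fun _ _ ↦ hG.contDiffOn_ginv b _ _

/-- `⟨S, T⟩` is `C^∞` on `V` for smooth `S, T`. [folklore] -/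
theorem IsMetricOn.contDiffOn_tinner [Fintype α] [DecidableEq α] (hG : IsMetricOn G V)
    {S T : E → (α → ι) → ℝ} (hS : TSmoothOn S V) (hT : TSmoothOn T V) :
    ContDiffOn ℝ ∞ (tinner G b S T) V := by
  unfold tinner
  exact ContDiffOn.sum fun I _ ↦ ContDiffOn.sum fun J _ ↦
    (hG.contDiffOn_prod_ginv I J).mul ((hS I).mul (hT J))

/-- `|T|²` is `C^∞` on `V` for smooth `T`. [folklore] -/
theorem IsMetricOn.contDiffOn_tnormSq [Fintype α] [DecidableEq α] (hG : IsMetricOn G V)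
    {T : E → (α → ι) → ℝ} (hT : TSmoothOn T V) : ContDiffOn ℝ ∞ (tnormSq G b T) V :=
  hG.contDiffOn_tinner hT hT

/-- The partial contraction of smooth fields is `C^∞` on `V`. [folklore] -/
theorem IsMetricOn.contDiffOn_pcontr [Fintype α] [DecidableEq α] (hG : IsMetricOn G V)
    {S : E → (Option α → ι) → ℝ} {T : E → (α → ι) → ℝ} (hS : TSmoothOn S V) (hT : TSmoothOn T V)
    (k : ι) : ContDiffOn ℝ ∞ (fun y ↦ pcontr G b S T y k) V := by
  simp only [pcontr_apply]
  exact ContDiffOn.sum fun I _ ↦ ContDiffOn.sum fun J _ ↦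
    (hG.contDiffOn_prod_ginv I J).mul ((hS _).mul (hT J))

end Smooth

/-! ### The Leibniz rule and the commutation of `∇` with the trace -/

section Leibniz

variable [Fintype ι] {G : E → E →L[ℝ] E →L[ℝ] ℝ} {b : Basis ι ℝ E} {α β : Type*} {V : Set E} {x : E}

omit [Fintype ι] in
/-- Moving a double sum past a double sum. [folklore] -/
theorem sum_comm₂₂ {κ₁ κ₂ κ₃ κ₄ : Type*} [Fintype κ₁] [Fintype κ₂] [Fintype κ₃] [Fintype κ₄]
    {R : Type*} [AddCommMonoid R] (f : κ₁ → κ₂ → κ₃ → κ₄ → R) :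
    ∑ a, ∑ m, ∑ p, ∑ q, f a m p q = ∑ p, ∑ q, ∑ a, ∑ m, f a m p q := by
  calc ∑ a, ∑ m, ∑ p, ∑ q, f a m p q = ∑ a, ∑ p, ∑ m, ∑ q, f a m p q :=
        Finset.sum_congr rfl fun a _ ↦ Finset.sum_comm
    _ = ∑ p, ∑ a, ∑ m, ∑ q, f a m p q := Finset.sum_comm
    _ = ∑ p, ∑ a, ∑ q, ∑ m, f a m p q :=
        Finset.sum_congr rfl fun p _ ↦ Finset.sum_congr rfl fun a _ ↦ Finset.sum_comm
    _ = ∑ p, ∑ q, ∑ a, ∑ m, f a m p q := Finset.sum_congr rfl fun p _ ↦ Finset.sum_comm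

/-- **Leibniz rule** `∇(S ⊗ T) = ∇S ⊗ T + S ⊗ ∇T` in components:
`(∇(S⊗T))_{j (I,J)} = (∇S)_{jI} T_J + S_I (∇T)_{jJ}` (O'Neill 1983, Ch. 2, Def. 2.9 (tensor
derivation) with Prop. 2.13). [cite: ONeill1983, Ch. 2, Prop. 2.13] -/
theorem tcov_tprod [Fintype α] [DecidableEq α] [Fintype β] [DecidableEq β] (hV : IsOpen V)
    {S : E → (α → ι) → ℝ} {T : E → (β → ι) → ℝ} (hS : TSmoothOn S V) (hT : TSmoothOn T V)
    (hx : x ∈ V) (K : Option (α ⊕ β) → ι) :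
    tcov G b (tprod S T) x K =
      tcov G b S x (ocons (K none) (K ∘ some ∘ Sum.inl)) * T x (K ∘ some ∘ Sum.inr)
        + S x (K ∘ some ∘ Sum.inl) * tcov G b T x (ocons (K none) (K ∘ some ∘ Sum.inr)) := by
  have hSd := hS.differentiableAt hV hx (K ∘ some ∘ Sum.inl)
  have hTd := hT.differentiableAt hV hx (K ∘ some ∘ Sum.inr)
  rw [tcov_apply, tcov_apply_ocons, tcov_apply_ocons]
  have hmul : fderiv ℝ (fun y ↦ tprod S T y (K ∘ some)) x (b (K none)) =
      fderiv ℝ (fun y ↦ S y (K ∘ some ∘ Sum.inl)) x (b (K none)) * T x (K ∘ some ∘ Sum.inr)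
        + S x (K ∘ some ∘ Sum.inl) * fderiv ℝ (fun y ↦ T y (K ∘ some ∘ Sum.inr)) x (b (K none)) := by
    have h := fderiv_fun_mul hSd hTd
    simp only [tprod_apply]
    rw [show (fun y ↦ S y ((K ∘ some) ∘ Sum.inl) * T y ((K ∘ some) ∘ Sum.inr)) =
        fun y ↦ S y (K ∘ some ∘ Sum.inl) * T y (K ∘ some ∘ Sum.inr) from rfl, h]
    simp only [_root_.add_apply, _root_.smul_apply, smul_eq_mul]
    ring
  rw [hmul, Fintype.sum_sum_type]
  simp only [tprod_apply, Sum.update_inl_comp_inl, Sum.update_inl_comp_inr,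
    Sum.update_inr_comp_inl, Sum.update_inr_comp_inr, Function.comp_assoc, Function.comp_apply]
  have hinl : ∑ a, ∑ m, chrCoef G b x (K none) (K (some (Sum.inl a))) m *
      (S x (update (K ∘ some ∘ Sum.inl) a m) * T x (K ∘ some ∘ Sum.inr)) =
      (∑ a, ∑ m, chrCoef G b x (K none) (K (some (Sum.inl a))) m *
        S x (update (K ∘ some ∘ Sum.inl) a m)) * T x (K ∘ some ∘ Sum.inr) := by
    rw [Finset.sum_mul]
    refine Finset.sum_congr rfl fun a _ ↦ ?_
    rw [Finset.sum_mul]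
    exact Finset.sum_congr rfl fun m _ ↦ by ring
  have hinr : ∑ c, ∑ m, chrCoef G b x (K none) (K (some (Sum.inr c))) m *
      (S x (K ∘ some ∘ Sum.inl) * T x (update (K ∘ some ∘ Sum.inr) c m)) =
      S x (K ∘ some ∘ Sum.inl) * ∑ c, ∑ m, chrCoef G b x (K none) (K (some (Sum.inr c))) m *
        T x (update (K ∘ some ∘ Sum.inr) c m) := by
    rw [Finset.mul_sum]
    refine Finset.sum_congr rfl fun c _ ↦ ?_
    rw [Finset.mul_sum]
    exact Finset.sum_congr rfl fun m _ ↦ by ring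
  rw [hinl, hinr]
  ring

variable [CompleteSpace E] [FiniteDimensional ℝ E]

/-- The derivative of the trace of a smooth tensor field. [folklore] -/
theorem IsMetricOn.fderiv_ttr_apply (hG : IsMetricOn G V) {T : E → (Option (Option α) → ι) → ℝ}
    (hT : TSmoothOn T V) (hx : x ∈ V) (I : α → ι) (v : E) :
    fderiv ℝ (fun y ↦ ttr G b T y I) x v =
      ∑ p, ∑ q, (fderiv ℝ (fun y ↦ ginv G b y p q) x v * T x (ocons p (ocons q I))
        + ginv G b x p q * fderiv ℝ (fun y ↦ T y (ocons p (ocons q I))) x v) := by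
  have hgd : ∀ p q, DifferentiableAt ℝ (fun y ↦ ginv G b y p q) x := fun p q ↦
    ((hG.contDiffOn_ginv b p q).contDiffAt (hG.isOpen.mem_nhds hx)).differentiableAt (by simp)
  have hTd : ∀ J, DifferentiableAt ℝ (fun y ↦ T y J) x := fun J ↦ hT.differentiableAt hG.isOpen hx J
  have hd : ∀ p q, DifferentiableAt ℝ (fun y ↦ ginv G b y p q * T y (ocons p (ocons q I))) x :=
    fun p q ↦ (hgd p q).fun_mul (hTd _)
  have hd' : ∀ p, DifferentiableAt ℝ (fun y ↦ ∑ q, ginv G b y p q * T y (ocons p (ocons q I))) x :=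
    fun p ↦ DifferentiableAt.fun_sum fun q _ ↦ hd p q
  have h : (fun y ↦ ttr G b T y I) =
      fun y ↦ ∑ p, ∑ q, ginv G b y p q * T y (ocons p (ocons q I)) := rfl
  rw [h, fderiv_fun_sum fun p _ ↦ hd' p, FunLike.coe_sum, Finset.sum_apply]
  refine Finset.sum_congr rfl fun p _ ↦ ?_
  rw [fderiv_fun_sum fun q _ ↦ hd p q, FunLike.coe_sum, Finset.sum_apply]
  refine Finset.sum_congr rfl fun q _ ↦ ?_
  rw [fderiv_fun_mul (hgd p q) (hTd _)]
  simp only [_root_.add_apply, _root_.smul_apply, smul_eq_mul]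
  ring

/-- **`∇` commutes with the metric trace** (`∇ g⁻¹ = 0`: O'Neill 1983, Ch. 2, Prop. 2.13 — `∇`
commutes with contractions — with Ch. 3, Prop. 3.13, metric compatibility):
`(∇ tr T)_{j I} = Σ_{pq} g^{pq} (∇T)_{j p q I}`. [cite: ONeill1983, Ch. 3, Prop. 3.13] -/
theorem IsMetricOn.tcov_ttr [Fintype α] [DecidableEq α] (hG : IsMetricOn G V)
    {T : E → (Option (Option α) → ι) → ℝ} (hT : TSmoothOn T V) (hx : x ∈ V) (j : ι) (I : α → ι) :
    tcov G b (ttr G b T) x (ocons j I) =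
      ∑ p, ∑ q, ginv G b x p q * tcov G b T x (ocons j (ocons p (ocons q I))) := by
  -- expansion of the right-hand side
  have hR : ∀ p q, tcov G b T x (ocons j (ocons p (ocons q I))) =
      fderiv ℝ (fun y ↦ T y (ocons p (ocons q I))) x (b j)
        - ∑ m, chrCoef G b x j p m * T x (ocons m (ocons q I))
        - ∑ m, chrCoef G b x j q m * T x (ocons p (ocons m I))
        - ∑ a, ∑ m, chrCoef G b x j (I a) m * T x (ocons p (ocons q (update I a m))) := by
    intro p q
    rw [tcov_apply_ocons, Fintype.sum_option, Fintype.sum_option]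
    simp only [ocons_none, ocons_some, update_ocons_none, update_ocons_some]
    ring
  -- expansion of the left-hand side
  have hL : tcov G b (ttr G b T) x (ocons j I) =
      ∑ p, ∑ q, (fderiv ℝ (fun y ↦ ginv G b y p q) x (b j) * T x (ocons p (ocons q I))
        + ginv G b x p q * fderiv ℝ (fun y ↦ T y (ocons p (ocons q I))) x (b j))
      - ∑ a, ∑ m, chrCoef G b x j (I a) m *
          ∑ p, ∑ q, ginv G b x p q * T x (ocons p (ocons q (update I a m))) := by
    rw [tcov_apply_ocons, hG.fderiv_ttr_apply hT hx]
    rfl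
  -- the derivative of `g^{pq}` against `T`
  have hA : ∑ p, ∑ q, (∑ c, ginv G b x p c * chrCoef G b x j c q) * T x (ocons p (ocons q I)) =
      ∑ p, ∑ q, ginv G b x p q * ∑ m, chrCoef G b x j q m * T x (ocons p (ocons m I)) := by
    refine Finset.sum_congr rfl fun p _ ↦ ?_
    simp only [Finset.sum_mul, Finset.mul_sum]
    rw [Finset.sum_comm]
    exact Finset.sum_congr rfl fun c _ ↦ Finset.sum_congr rfl fun q _ ↦ by ring
  have hB : ∑ p, ∑ q, (∑ d, chrCoef G b x j d p * ginv G b x d q) * T x (ocons p (ocons q I)) =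
      ∑ p, ∑ q, ginv G b x p q * ∑ m, chrCoef G b x j p m * T x (ocons m (ocons q I)) := by
    simp only [Finset.sum_mul, Finset.mul_sum]
    rw [sum_comm₃]
    refine Finset.sum_congr rfl fun d _ ↦ ?_
    rw [Finset.sum_comm]
    exact Finset.sum_congr rfl fun q _ ↦ Finset.sum_congr rfl fun p _ ↦ by ring
  have hdg : ∀ p q, fderiv ℝ (fun y ↦ ginv G b y p q) x (b j) =
      -(∑ c, ginv G b x p c * chrCoef G b x j c q) - ∑ d, chrCoef G b x j d p * ginv G b x d q :=
    fun p q ↦ hG.fderiv_ginv_eq_chrCoef b hx p q j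
  have hC : ∑ a, ∑ m, chrCoef G b x j (I a) m *
      ∑ p, ∑ q, ginv G b x p q * T x (ocons p (ocons q (update I a m))) =
      ∑ p, ∑ q, ginv G b x p q *
        ∑ a, ∑ m, chrCoef G b x j (I a) m * T x (ocons p (ocons q (update I a m))) := by
    simp only [Finset.mul_sum]
    rw [sum_comm₂₂]
    exact Finset.sum_congr rfl fun p _ ↦ Finset.sum_congr rfl fun q _ ↦
      Finset.sum_congr rfl fun a _ ↦ Finset.sum_congr rfl fun m _ ↦ by ring
  rw [hL, hC]
  simp only [hR, hdg, Finset.sum_add_distrib, mul_sub, Finset.sum_sub_distrib, neg_mul,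
    sub_mul, Finset.sum_neg_distrib]
  rw [hA, hB]
  ring

end Leibniz

/-! ### Metric compatibility of the contraction -/

section PointAlgebra

variable {ι : Type*} [Fintype ι] {α : Type*} [Fintype α] [DecidableEq α]
  (g : ι → ι → ℝ) (Γ' : ι → ι → ℝ)

omit [Fintype ι] in
/-- Splitting off one factor of `Π_{a'} g^{I a', J a'}` after an update of `I` at `a`. [folklore] -/
theorem prod_update_left (I J : α → ι) (a : α) (c : ι) :
    ∏ a', g (update I a c a') (J a') = g c (J a) * ∏ a' ∈ Finset.univ.erase a, g (I a') (J a') := by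
  rw [← Finset.mul_prod_erase Finset.univ _ (Finset.mem_univ a), update_self]
  congr 1
  exact Finset.prod_congr rfl fun a' ha' ↦ by rw [update_of_ne (Finset.ne_of_mem_erase ha')]

omit [Fintype ι] in
/-- Splitting off one factor of `Π_{a'} g^{I a', J a'}` after an update of `J` at `a`. [folklore] -/
theorem prod_update_right (I J : α → ι) (a : α) (c : ι) :
    ∏ a', g (I a') (update J a c a') = g (I a) c * ∏ a' ∈ Finset.univ.erase a, g (I a') (J a') := by
  rw [← Finset.mul_prod_erase Finset.univ _ (Finset.mem_univ a), update_self]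
  congr 1
  exact Finset.prod_congr rfl fun a' ha' ↦ by rw [update_of_ne (Finset.ne_of_mem_erase ha')]

/-- Innermost sum to the front (three sums of possibly different index types). [folklore] -/
theorem sum_comm₃' {κ₁ κ₂ κ₃ : Type*} [Fintype κ₁] [Fintype κ₂] [Fintype κ₃]
    {R : Type*} [AddCommMonoid R] (f : κ₁ → κ₂ → κ₃ → R) :
    ∑ p, ∑ q, ∑ d, f p q d = ∑ d, ∑ p, ∑ q, f p q d := by
  calc ∑ p, ∑ q, ∑ d, f p q d = ∑ p, ∑ d, ∑ q, f p q d :=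
        Finset.sum_congr rfl fun p _ ↦ Finset.sum_comm
    _ = ∑ d, ∑ p, ∑ q, f p q d := Finset.sum_comm

/-- **The slot identity behind `∇ g⁻¹ = 0`, left slot**: for arrays `S₀, T₀`,
`Σ_{IJ} (Π_{a'≠a} g^{I J}) (Σ_d Γ^{I_a}_{d} g^{d J_a}) S₀_I T₀_J = Σ_{IJ} (Π g^{IJ}) (Σ_m Γ^m_{I_a} S₀_{I[a↦m]}) T₀_J`
(re-summation `(I, m) ↦ (I[a↦m], I a)`). [cite: ONeill1983, Ch. 3, p. 86] -/
theorem sum_prod_erase_mul_left (a : α) (S₀ T₀ : (α → ι) → ℝ) :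
    ∑ I : α → ι, ∑ J : α → ι, (∏ a' ∈ Finset.univ.erase a, g (I a') (J a')) *
        (∑ d, Γ' d (I a) * g d (J a)) * (S₀ I * T₀ J) =
      ∑ I : α → ι, ∑ J : α → ι, (∏ a', g (I a') (J a')) *
        ((∑ m, Γ' (I a) m * S₀ (update I a m)) * T₀ J) := by
  symm
  -- right-hand side: move `m` next to `I` and re-sum
  have h1 : ∑ I : α → ι, ∑ J : α → ι, (∏ a', g (I a') (J a')) *
      ((∑ m, Γ' (I a) m * S₀ (update I a m)) * T₀ J) =
      ∑ I : α → ι, ∑ m, ∑ J : α → ι, (∏ a', g (I a') (J a')) * (Γ' (I a) m * S₀ (update I a m)) * T₀ J := by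
    refine Finset.sum_congr rfl fun I _ ↦ ?_
    rw [Finset.sum_comm]
    refine Finset.sum_congr rfl fun J _ ↦ ?_
    rw [Finset.sum_mul, Finset.mul_sum]
    exact Finset.sum_congr rfl fun m _ ↦ by ring
  rw [h1, sum_sum_update_swap _ a]
  simp only [update_self, update_idem, update_eq_self, prod_update_left]
  -- left-hand side
  refine Finset.sum_congr rfl fun I _ ↦ ?_
  rw [Finset.sum_comm]
  simp only [Finset.mul_sum, Finset.sum_mul]
  exact Finset.sum_congr rfl fun J _ ↦ Finset.sum_congr rfl fun c _ ↦ by ring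

/-- **The slot identity behind `∇ g⁻¹ = 0`, right slot** (the same with the roles of `I` and `J`
exchanged). [cite: ONeill1983, Ch. 3, p. 86] -/
theorem sum_prod_erase_mul_right (a : α) (S₀ T₀ : (α → ι) → ℝ) :
    ∑ I : α → ι, ∑ J : α → ι, (∏ a' ∈ Finset.univ.erase a, g (I a') (J a')) *
        (∑ c, g (I a) c * Γ' c (J a)) * (S₀ I * T₀ J) =
      ∑ I : α → ι, ∑ J : α → ι, (∏ a', g (I a') (J a')) *
        (S₀ I * ∑ m, Γ' (J a) m * T₀ (update J a m)) := by
  symm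
  rw [Finset.sum_comm]
  have h1 : ∑ J : α → ι, ∑ I : α → ι, (∏ a', g (I a') (J a')) *
      (S₀ I * ∑ m, Γ' (J a) m * T₀ (update J a m)) =
      ∑ J : α → ι, ∑ m, ∑ I : α → ι, (∏ a', g (I a') (J a')) * S₀ I * (Γ' (J a) m * T₀ (update J a m)) := by
    refine Finset.sum_congr rfl fun J _ ↦ ?_
    rw [Finset.sum_comm]
    refine Finset.sum_congr rfl fun I _ ↦ ?_
    rw [Finset.mul_sum, Finset.mul_sum]
    exact Finset.sum_congr rfl fun m _ ↦ by ring
  rw [h1, sum_sum_update_swap _ a]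
  simp only [update_self, update_idem, update_eq_self, prod_update_right]
  rw [sum_comm₃']
  refine Finset.sum_congr rfl fun I _ ↦ Finset.sum_congr rfl fun J _ ↦ ?_
  simp only [Finset.mul_sum, Finset.sum_mul]
  exact Finset.sum_congr rfl fun c _ ↦ by ring

/-- **The derivative of `Π_a g^{I_a J_a}` paired against two arrays is minus the pairing of the
Christoffel derivations** — the pointwise algebra of `∂_j ⟨S, T⟩ = ⟨∇_j S, T⟩ + ⟨S, ∇_j T⟩`.
[cite: ONeill1983, Ch. 3, p. 86] -/
theorem sum_dprod_pair (S₀ T₀ : (α → ι) → ℝ) :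
    ∑ I : α → ι, ∑ J : α → ι, (∑ a, (∏ a' ∈ Finset.univ.erase a, g (I a') (J a')) *
        (-(∑ c, g (I a) c * Γ' c (J a)) - ∑ d, Γ' d (I a) * g d (J a))) * (S₀ I * T₀ J) =
      -(∑ I : α → ι, ∑ J : α → ι, (∏ a', g (I a') (J a')) *
          ((∑ a, ∑ m, Γ' (I a) m * S₀ (update I a m)) * T₀ J))
        - ∑ I : α → ι, ∑ J : α → ι, (∏ a', g (I a') (J a')) *
          (S₀ I * ∑ a, ∑ m, Γ' (J a) m * T₀ (update J a m)) := by
  have hA : ∑ a, ∑ I : α → ι, ∑ J : α → ι, (∏ a' ∈ Finset.univ.erase a, g (I a') (J a')) *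
      (∑ d, Γ' d (I a) * g d (J a)) * (S₀ I * T₀ J) =
      ∑ I : α → ι, ∑ J : α → ι, (∏ a', g (I a') (J a')) *
        ((∑ a, ∑ m, Γ' (I a) m * S₀ (update I a m)) * T₀ J) := by
    simp only [sum_prod_erase_mul_left]
    simp only [Finset.sum_mul, Finset.mul_sum]
    exact (sum_comm₃' fun (I J : α → ι) (a : α) ↦
      ∑ m, (∏ a', g (I a') (J a')) * (Γ' (I a) m * S₀ (update I a m) * T₀ J)).symm
  have hB : ∑ a, ∑ I : α → ι, ∑ J : α → ι, (∏ a' ∈ Finset.univ.erase a, g (I a') (J a')) *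
      (∑ c, g (I a) c * Γ' c (J a)) * (S₀ I * T₀ J) =
      ∑ I : α → ι, ∑ J : α → ι, (∏ a', g (I a') (J a')) *
        (S₀ I * ∑ a, ∑ m, Γ' (J a) m * T₀ (update J a m)) := by
    simp only [sum_prod_erase_mul_right]
    simp only [Finset.mul_sum]
    exact (sum_comm₃' fun (I J : α → ι) (a : α) ↦
      ∑ m, (∏ a', g (I a') (J a')) * (S₀ I * (Γ' (J a) m * T₀ (update J a m)))).symm
  calc ∑ I : α → ι, ∑ J : α → ι, (∑ a, (∏ a' ∈ Finset.univ.erase a, g (I a') (J a')) *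
        (-(∑ c, g (I a) c * Γ' c (J a)) - ∑ d, Γ' d (I a) * g d (J a))) * (S₀ I * T₀ J)
      = ∑ I : α → ι, ∑ J : α → ι, ∑ a,
          (-((∏ a' ∈ Finset.univ.erase a, g (I a') (J a')) *
              (∑ c, g (I a) c * Γ' c (J a)) * (S₀ I * T₀ J))
            - (∏ a' ∈ Finset.univ.erase a, g (I a') (J a')) *
              (∑ d, Γ' d (I a) * g d (J a)) * (S₀ I * T₀ J)) := by
        refine Finset.sum_congr rfl fun I _ ↦ Finset.sum_congr rfl fun J _ ↦ ?_
        rw [Finset.sum_mul]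
        exact Finset.sum_congr rfl fun a _ ↦ by ring
    _ = -(∑ I : α → ι, ∑ J : α → ι, ∑ a, (∏ a' ∈ Finset.univ.erase a, g (I a') (J a')) *
              (∑ c, g (I a) c * Γ' c (J a)) * (S₀ I * T₀ J))
          - ∑ I : α → ι, ∑ J : α → ι, ∑ a, (∏ a' ∈ Finset.univ.erase a, g (I a') (J a')) *
              (∑ d, Γ' d (I a) * g d (J a)) * (S₀ I * T₀ J) := by
        simp only [Finset.sum_sub_distrib, Finset.sum_neg_distrib]
    _ = -(∑ a, ∑ I : α → ι, ∑ J : α → ι, (∏ a' ∈ Finset.univ.erase a, g (I a') (J a')) *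
              (∑ c, g (I a) c * Γ' c (J a)) * (S₀ I * T₀ J))
          - ∑ a, ∑ I : α → ι, ∑ J : α → ι, (∏ a' ∈ Finset.univ.erase a, g (I a') (J a')) *
              (∑ d, Γ' d (I a) * g d (J a)) * (S₀ I * T₀ J) := by
        rw [sum_comm₃' fun (I J : α → ι) (a : α) ↦ (∏ a' ∈ Finset.univ.erase a, g (I a') (J a')) *
              (∑ c, g (I a) c * Γ' c (J a)) * (S₀ I * T₀ J),
          sum_comm₃' fun (I J : α → ι) (a : α) ↦ (∏ a' ∈ Finset.univ.erase a, g (I a') (J a')) *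
              (∑ d, Γ' d (I a) * g d (J a)) * (S₀ I * T₀ J)]
    _ = _ := by rw [hA, hB]; ring

end PointAlgebra

section Compat

variable [Fintype ι] {G : E → E →L[ℝ] E →L[ℝ] ℝ} {b : Basis ι ℝ E} {α : Type*} [Fintype α] [DecidableEq α]
  {V : Set E} {x : E} [CompleteSpace E] [FiniteDimensional ℝ E]

/-- The derivative of `y ↦ Π_a g^{I_a J_a}(y)` along `b_j`. [cite: ONeill1983, Ch. 3, p. 86] -/
theorem IsMetricOn.fderiv_prod_ginv (hG : IsMetricOn G V) (hx : x ∈ V) (I J : α → ι) (j : ι) :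
    fderiv ℝ (fun y ↦ ∏ a, ginv G b y (I a) (J a)) x (b j) =
      ∑ a, (∏ a' ∈ Finset.univ.erase a, ginv G b x (I a') (J a')) *
        (-(∑ c, ginv G b x (I a) c * chrCoef G b x j c (J a))
          - ∑ d, chrCoef G b x j d (I a) * ginv G b x d (J a)) := by
  have hgd : ∀ p q, DifferentiableAt ℝ (fun y ↦ ginv G b y p q) x := fun p q ↦
    ((hG.contDiffOn_ginv b p q).contDiffAt (hG.isOpen.mem_nhds hx)).differentiableAt (by simp)
  have hP : HasFDerivAt (fun y ↦ ∏ a, ginv G b y (I a) (J a))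
      (∑ a, (∏ a' ∈ Finset.univ.erase a, ginv G b x (I a') (J a')) •
        fderiv ℝ (fun y ↦ ginv G b y (I a) (J a)) x) x :=
    HasFDerivAt.finsetProd fun a _ ↦ (hgd (I a) (J a)).hasFDerivAt
  rw [hP.fderiv, FunLike.coe_sum, Finset.sum_apply]
  refine Finset.sum_congr rfl fun a _ ↦ ?_
  rw [_root_.smul_apply, smul_eq_mul, hG.fderiv_ginv_eq_chrCoef b hx]

omit [DecidableEq α] [CompleteSpace E] in
/-- `y ↦ Π_a g^{I_a J_a}(y)` is differentiable at the points of `V`. [folklore] -/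
theorem IsMetricOn.differentiableAt_prod_ginv (hG : IsMetricOn G V) (hx : x ∈ V) (I J : α → ι) :
    DifferentiableAt ℝ (fun y ↦ ∏ a, ginv G b y (I a) (J a)) x :=
  ((hG.contDiffOn_prod_ginv I J).contDiffAt (hG.isOpen.mem_nhds hx)).differentiableAt (by simp)

/-- **Metric compatibility of the contraction with one free slot**: for `ω_k = ⟨S_{k·}, T⟩`,
`∂_j ω_k = ⟨(∇_j S)_{k·}, T⟩ + ⟨S_{k·}, ∇_j T⟩ + Γ^m_{jk} ω_m`, i.e. `(∇_j ω)_k = ⟨(∇_jS)_{k·},T⟩ +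
⟨S_{k·}, ∇_jT⟩` (`∇` is a derivation commuting with contractions, O'Neill 1983, Ch. 2, Prop. 2.13,
and `∇g = 0`, Ch. 3, Prop. 3.13). [cite: ONeill1983, Ch. 3, Prop. 3.13] -/
theorem IsMetricOn.fderiv_pcontr (hG : IsMetricOn G V) {S : E → (Option α → ι) → ℝ}
    {T : E → (α → ι) → ℝ} (hS : TSmoothOn S V) (hT : TSmoothOn T V) (hx : x ∈ V) (j k : ι) :
    fderiv ℝ (fun y ↦ pcontr G b S T y k) x (b j) =
      pcontr G b (fun y J ↦ tcov G b S y (ocons j J)) T x k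
        + pcontr G b S (fun y I ↦ tcov G b T y (ocons j I)) x k
        + ∑ m, chrCoef G b x j k m * pcontr G b S T x m := by
  have hSd : ∀ J, DifferentiableAt ℝ (fun y ↦ S y J) x := fun J ↦ hS.differentiableAt hG.isOpen hx J
  have hTd : ∀ I, DifferentiableAt ℝ (fun y ↦ T y I) x := fun I ↦ hT.differentiableAt hG.isOpen hx I
  have hPd := fun I J : α → ι ↦ hG.differentiableAt_prod_ginv (b := b) hx I J
  -- Step 1: differentiate the double sum
  have hD : fderiv ℝ (fun y ↦ pcontr G b S T y k) x (b j) =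
      ∑ I : α → ι, ∑ J : α → ι,
        (fderiv ℝ (fun y ↦ ∏ a, ginv G b y (I a) (J a)) x (b j) * (S x (ocons k I) * T x J)
          + (∏ a, ginv G b x (I a) (J a)) *
            (fderiv ℝ (fun y ↦ S y (ocons k I)) x (b j) * T x J
              + S x (ocons k I) * fderiv ℝ (fun y ↦ T y J) x (b j))) := by
    have hST : ∀ I J, DifferentiableAt ℝ (fun y ↦ S y (ocons k I) * T y J) x :=
      fun I J ↦ (hSd _).fun_mul (hTd _)
    have hd : ∀ I J, DifferentiableAt ℝ
        (fun y ↦ (∏ a, ginv G b y (I a) (J a)) * (S y (ocons k I) * T y J)) x :=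
      fun I J ↦ (hPd I J).fun_mul (hST I J)
    have hd' : ∀ I, DifferentiableAt ℝ
        (fun y ↦ ∑ J : α → ι, (∏ a, ginv G b y (I a) (J a)) * (S y (ocons k I) * T y J)) x :=
      fun I ↦ DifferentiableAt.fun_sum fun J _ ↦ hd I J
    have h : (fun y ↦ pcontr G b S T y k) =
        fun y ↦ ∑ I : α → ι, ∑ J : α → ι, (∏ a, ginv G b y (I a) (J a)) * (S y (ocons k I) * T y J) :=
      rfl
    rw [h, fderiv_fun_sum fun I _ ↦ hd' I, FunLike.coe_sum, Finset.sum_apply]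
    refine Finset.sum_congr rfl fun I _ ↦ ?_
    rw [fderiv_fun_sum fun J _ ↦ hd I J, FunLike.coe_sum, Finset.sum_apply]
    refine Finset.sum_congr rfl fun J _ ↦ ?_
    rw [fderiv_fun_mul (hPd I J) (hST I J), fderiv_fun_mul (hSd _) (hTd _)]
    simp only [_root_.add_apply, _root_.smul_apply, smul_eq_mul]
    ring
  -- Step 2: the `∂(Π g)` part is minus the pairing of the Christoffel derivations
  have hX : ∑ I : α → ι, ∑ J : α → ι,
      fderiv ℝ (fun y ↦ ∏ a, ginv G b y (I a) (J a)) x (b j) * (S x (ocons k I) * T x J) =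
      -(∑ I : α → ι, ∑ J : α → ι, (∏ a', ginv G b x (I a') (J a')) *
          ((∑ a, ∑ m, chrCoef G b x j (I a) m * S x (ocons k (update I a m))) * T x J))
        - ∑ I : α → ι, ∑ J : α → ι, (∏ a', ginv G b x (I a') (J a')) *
          (S x (ocons k I) * ∑ a, ∑ m, chrCoef G b x j (J a) m * T x (update J a m)) := by
    rw [← sum_dprod_pair (ginv G b x) (chrCoef G b x j) (fun I ↦ S x (ocons k I)) (T x)]
    exact Finset.sum_congr rfl fun I _ ↦ Finset.sum_congr rfl fun J _ ↦ by
      rw [hG.fderiv_prod_ginv hx I J j]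
  -- Step 3: the three terms of the right-hand side
  have hR1 : pcontr G b (fun y J ↦ tcov G b S y (ocons j J)) T x k =
      ∑ I : α → ι, ∑ J : α → ι, (∏ a', ginv G b x (I a') (J a')) *
          (fderiv ℝ (fun y ↦ S y (ocons k I)) x (b j) * T x J)
        - ∑ I : α → ι, ∑ J : α → ι, (∏ a', ginv G b x (I a') (J a')) *
          ((∑ m, chrCoef G b x j k m * S x (ocons m I)) * T x J)
        - ∑ I : α → ι, ∑ J : α → ι, (∏ a', ginv G b x (I a') (J a')) *
          ((∑ a, ∑ m, chrCoef G b x j (I a) m * S x (ocons k (update I a m))) * T x J) := by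
    rw [pcontr_apply, ← Finset.sum_sub_distrib, ← Finset.sum_sub_distrib]
    refine Finset.sum_congr rfl fun I _ ↦ ?_
    rw [← Finset.sum_sub_distrib, ← Finset.sum_sub_distrib]
    refine Finset.sum_congr rfl fun J _ ↦ ?_
    rw [tcov_apply_ocons, Fintype.sum_option]
    simp only [ocons_none, ocons_some, update_ocons_none, update_ocons_some]
    ring
  have hR2 : pcontr G b S (fun y I ↦ tcov G b T y (ocons j I)) x k =
      ∑ I : α → ι, ∑ J : α → ι, (∏ a', ginv G b x (I a') (J a')) *
          (S x (ocons k I) * fderiv ℝ (fun y ↦ T y J) x (b j))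
        - ∑ I : α → ι, ∑ J : α → ι, (∏ a', ginv G b x (I a') (J a')) *
          (S x (ocons k I) * ∑ a, ∑ m, chrCoef G b x j (J a) m * T x (update J a m)) := by
    rw [pcontr_apply, ← Finset.sum_sub_distrib]
    refine Finset.sum_congr rfl fun I _ ↦ ?_
    rw [← Finset.sum_sub_distrib]
    refine Finset.sum_congr rfl fun J _ ↦ ?_
    rw [tcov_apply_ocons]
    ring
  have hR3 : ∑ m, chrCoef G b x j k m * pcontr G b S T x m =
      ∑ I : α → ι, ∑ J : α → ι, (∏ a', ginv G b x (I a') (J a')) *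
          ((∑ m, chrCoef G b x j k m * S x (ocons m I)) * T x J) := by
    simp only [pcontr_apply, Finset.mul_sum, Finset.sum_mul]
    rw [sum_comm₃' fun (I J : α → ι) (m : ι) ↦
      (∏ a', ginv G b x (I a') (J a')) * (chrCoef G b x j k m * S x (ocons m I) * T x J)]
    exact Finset.sum_congr rfl fun m _ ↦ Finset.sum_congr rfl fun I _ ↦
      Finset.sum_congr rfl fun J _ ↦ by ring
  rw [hD, Finset.sum_congr rfl fun I _ ↦ Finset.sum_add_distrib, Finset.sum_add_distrib, hX,
    hR1, hR2, hR3]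
  simp only [mul_add, Finset.sum_add_distrib]
  ring

/-- **Metric compatibility of the full contraction**: `∂_j ⟨S, T⟩ = ⟨∇_j S, T⟩ + ⟨S, ∇_j T⟩`
(Topping 2006, §2.1: `∇` is compatible with `⟨·,·⟩` on tensors). [cite: ONeill1983, Ch. 3, Prop. 3.13] -/
theorem IsMetricOn.fderiv_tinner (hG : IsMetricOn G V) {S T : E → (α → ι) → ℝ}
    (hS : TSmoothOn S V) (hT : TSmoothOn T V) (hx : x ∈ V) (j : ι) :
    fderiv ℝ (tinner G b S T) x (b j) =
      tinner G b (fun y I ↦ tcov G b S y (ocons j I)) T x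
        + tinner G b S (fun y I ↦ tcov G b T y (ocons j I)) x := by
  -- view `S` as a tensor with a dummy first slot
  have hS' : TSmoothOn (fun y (J : Option α → ι) ↦ S y (J ∘ some)) V := fun J ↦ hS _
  have h := hG.fderiv_pcontr (b := b) hS' hT hx j j
  simp only [pcontr_const_slot] at h
  rw [show (fun y ↦ tinner G b S T y) = tinner G b S T from rfl] at h
  rw [h]
  -- the dummy slot contributes `−Γ^m_{jj} ⟨S, T⟩`, which cancels
  have h1 : pcontr G b (fun y J ↦ tcov G b (fun y (J : Option α → ι) ↦ S y (J ∘ some)) y (ocons j J)) T x j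
      = tinner G b (fun y I ↦ tcov G b S y (ocons j I)) T x
        - ∑ m, chrCoef G b x j j m * tinner G b S T x := by
    have h2 : ∀ I : α → ι, tcov G b (fun y (J : Option α → ι) ↦ S y (J ∘ some)) x (ocons j (ocons j I))
        = tcov G b S x (ocons j I) - ∑ m, chrCoef G b x j j m * S x I := by
      intro I
      rw [tcov_apply_ocons, tcov_apply_ocons, Fintype.sum_option]
      simp only [ocons_none, ocons_some, update_ocons_none, update_ocons_some, ocons_comp_some]
      ring
    simp only [pcontr_apply, tinner_apply, h2, sub_mul, mul_sub, Finset.sum_sub_distrib, Finset.mul_sum,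
      Finset.sum_mul]
    congr 1
    rw [sum_comm₃']
    exact Finset.sum_congr rfl fun I _ ↦ Finset.sum_congr rfl fun J _ ↦
      Finset.sum_congr rfl fun m _ ↦ by ring
  rw [h1]
  ring

/-- **`∂_j |T|² = 2 ⟨∇_j T, T⟩`.** [cite: Topping2006, §3.2, p. 37 (`d|Rm|² = 2⟨Rm, ∇Rm⟩`)] -/
theorem IsMetricOn.fderiv_tnormSq (hG : IsMetricOn G V) {T : E → (α → ι) → ℝ} (hT : TSmoothOn T V)
    (hx : x ∈ V) (j : ι) :
    fderiv ℝ (tnormSq G b T) x (b j) = 2 * tinner G b (fun y I ↦ tcov G b T y (ocons j I)) T x := by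
  have hgs : ∀ p q, ginv G b x p q = ginv G b x q p :=
    fun p q ↦ ginv_comm b (hG.isInvertible x hx) (hG.symm x hx) p q
  rw [show tnormSq G b T = tinner G b T T from rfl, hG.fderiv_tinner hT hT hx j,
    tinner_comm hgs T]
  ring

end Compat

/-! ### Linearity of `∇` on `V`, the Laplacian, products and the scalar bridge -/

section More

variable [Fintype ι] {G : E → E →L[ℝ] E →L[ℝ] ℝ} {b : Basis ι ℝ E} {α β : Type*} [Fintype α] [DecidableEq α]
  {V : Set E} {x : E}

/-- `∇` is additive (at points of the open set where both fields are smooth). [folklore] -/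
theorem tcov_add_apply (hV : IsOpen V) {S T : E → (α → ι) → ℝ} (hS : TSmoothOn S V)
    (hT : TSmoothOn T V) (hx : x ∈ V) (J : Option α → ι) :
    tcov G b (S + T) x J = tcov G b S x J + tcov G b T x J := by
  simp only [tcov_apply, Pi.add_apply]
  rw [fderiv_fun_add (hS.differentiableAt hV hx _) (hT.differentiableAt hV hx _)]
  simp only [_root_.add_apply, mul_add, Finset.sum_add_distrib]
  ring

/-- `∇` commutes with subtraction (at points of the open set where both fields are smooth). [folklore] -/
theorem tcov_sub_apply (hV : IsOpen V) {S T : E → (α → ι) → ℝ} (hS : TSmoothOn S V)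
    (hT : TSmoothOn T V) (hx : x ∈ V) (J : Option α → ι) :
    tcov G b (S - T) x J = tcov G b S x J - tcov G b T x J := by
  simp only [tcov_apply, Pi.sub_apply]
  rw [fderiv_fun_sub (hS.differentiableAt hV hx _) (hT.differentiableAt hV hx _)]
  simp only [_root_.sub_apply, mul_sub, Finset.sum_sub_distrib]
  ring

/-- `∇` commutes with scalar multiplication (at points where the field is smooth). [folklore] -/
theorem tcov_smul_apply (hV : IsOpen V) {T : E → (α → ι) → ℝ} (hT : TSmoothOn T V) (c : ℝ)
    (hx : x ∈ V) (J : Option α → ι) :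
    tcov G b (c • T) x J = c * tcov G b T x J := by
  simp only [tcov_apply, Pi.smul_apply, smul_eq_mul]
  rw [fderiv_const_mul (hT.differentiableAt hV hx _) c]
  simp only [_root_.smul_apply, smul_eq_mul, Finset.mul_sum, mul_sub]
  congr 1
  exact Finset.sum_congr rfl fun a _ ↦ Finset.sum_congr rfl fun m _ ↦ by ring

/-- `∇` commutes with negation (at points where the field is smooth). [folklore] -/
theorem tcov_neg_apply (hV : IsOpen V) {T : E → (α → ι) → ℝ} (hT : TSmoothOn T V) (hx : x ∈ V)
    (J : Option α → ι) : tcov G b (-T) x J = -tcov G b T x J := by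
  rw [show -T = (-1 : ℝ) • T by simp, tcov_smul_apply hV hT (-1) hx]
  ring

omit [DecidableEq α] in
/-- `∇ 0 = 0`. [folklore] -/
theorem tcov_zero [DecidableEq α] : tcov G b (0 : E → (α → ι) → ℝ) = 0 := by
  funext x J
  simp [tcov_apply]

/-- `∇` only depends on the values on the open set `V`. [folklore] -/
theorem tcov_congr (hV : IsOpen V) {S T : E → (α → ι) → ℝ} (h : ∀ y ∈ V, ∀ I, S y I = T y I)
    (hx : x ∈ V) (J : Option α → ι) : tcov G b S x J = tcov G b T x J := by
  simp only [tcov_apply]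
  have hev : (fun y ↦ S y (J ∘ some)) =ᶠ[𝓝 x] fun y ↦ T y (J ∘ some) :=
    Filter.eventually_of_mem (hV.mem_nhds hx) fun y hy ↦ h y hy _
  rw [hev.fderiv_eq]
  simp only [h x hx]

variable [FiniteDimensional ℝ E]

/-- The Laplacian commutes with relabelling. [folklore] -/
theorem tlap_treindex [Fintype β] [DecidableEq β] (e : α ≃ β) (T : E → (α → ι) → ℝ) :
    tlap G b (treindex e T) = treindex e (tlap G b T) := by
  unfold tlap
  rw [tcov_treindex, tcov_treindex, treindex_ttr]

/-- **The inner product of tensor products factors**: `⟨S ⊗ T, S' ⊗ T'⟩ = ⟨S, S'⟩ ⟨T, T'⟩`.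
[cite: ONeill1983, Ch. 2, Lemma 2.31 ff.] -/
theorem tinner_tprod [Fintype β] [DecidableEq β] (S S' : E → (α → ι) → ℝ) (T T' : E → (β → ι) → ℝ) :
    tinner G b (tprod S T) (tprod S' T') x = tinner G b S S' x * tinner G b T T' x := by
  simp only [tinner_apply, tprod_apply]
  have hE : ∀ F : (α ⊕ β → ι) → ℝ, ∑ K : α ⊕ β → ι, F K =
      ∑ I : α → ι, ∑ I' : β → ι, F (Sum.elim I I') := by
    intro F
    rw [← (Equiv.sumArrowEquivProdArrow α β ι).symm.sum_comp, Fintype.sum_prod_type]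
    rfl
  rw [hE]
  simp only [hE, Fintype.prod_sum_type, Sum.elim_inl, Sum.elim_inr, Sum.elim_comp_inl,
    Sum.elim_comp_inr]
  rw [Finset.sum_mul_sum]
  refine Finset.sum_congr rfl fun I _ ↦ Finset.sum_congr rfl fun I' _ ↦ ?_
  rw [Finset.sum_mul_sum]
  exact Finset.sum_congr rfl fun J _ ↦ Finset.sum_congr rfl fun J' _ ↦ by ring

/-- **`|S ⊗ T|² = |S|² |T|²`.** [cite: ONeill1983, Ch. 2, Lemma 2.31 ff.] -/
theorem tnormSq_tprod [Fintype β] [DecidableEq β] (S : E → (α → ι) → ℝ) (T : E → (β → ι) → ℝ) :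
    tnormSq G b (tprod S T) x = tnormSq G b S x * tnormSq G b T x :=
  tinner_tprod S S T T

/-- **The inner product of tensors with a distinguished first slot**:
`⟨S, T⟩ = Σ_{kl} g^{kl} Σ_{IJ} (Π g^{IJ}) S_{kI} T_{lJ}` (e.g. `|∇T|²`). [cite: Topping2006, §2.1] -/
theorem tinner_option (S T : E → (Option α → ι) → ℝ) :
    tinner G b S T x = ∑ k, ∑ l, ginv G b x k l *
      ∑ I : α → ι, ∑ J : α → ι, (∏ a, ginv G b x (I a) (J a)) * (S x (ocons k I) * T x (ocons l J)) := by
  rw [tinner_apply]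
  have hE : ∀ F : (Option α → ι) → ℝ, ∑ K : Option α → ι, F K = ∑ k, ∑ I : α → ι, F (ocons k I) := by
    intro F
    rw [← (Equiv.piOptionEquivProd (β := fun _ ↦ ι)).symm.sum_comp, Fintype.sum_prod_type]
    refine Finset.sum_congr rfl fun k _ ↦ Finset.sum_congr rfl fun I _ ↦ ?_
    congr 1
    funext o; cases o <;> rfl
  rw [hE]
  simp only [hE, Fintype.prod_option, ocons_none, ocons_some]
  refine Finset.sum_congr rfl fun k _ ↦ ?_
  rw [Finset.sum_comm]
  refine Finset.sum_congr rfl fun l _ ↦ ?_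
  rw [Finset.mul_sum]
  refine Finset.sum_congr rfl fun I _ ↦ ?_
  rw [Finset.mul_sum]
  exact Finset.sum_congr rfl fun J _ ↦ by ring

/-- **The rough Laplacian of a scalar is the coordinate Laplace–Beltrami operator**: for a scalar
`f` viewed as a tensor with no slots, `tlap (f) = lapAt G f = g^{jk}(∂_j∂_k f − Γ^m_{jk} ∂_m f)`.
[cite: ONeill1983, Ch. 3, Def. 3.50] -/
theorem tlap_scalar {κ : Type*} [Fintype κ] [DecidableEq κ] [IsEmpty κ] (hV : IsOpen V)
    {f : E → ℝ} (hf : ContDiffOn ℝ ∞ f V) (hx : x ∈ V) (I : κ → ι) :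
    tlap G b (fun y (_ : κ → ι) ↦ f y) x I = lapAt G f x := by
  have h1 : ∀ y, ∀ J : Option κ → ι,
      tcov G b (fun y (_ : κ → ι) ↦ f y) y J = fderiv ℝ f y (b (J none)) := by
    intro y J
    rw [tcov_apply]
    simp only [Fintype.sum_empty, sub_zero]
  have hfd : DifferentiableAt ℝ (fderiv ℝ f) x :=
    ((hf.fderiv_of_isOpen (m := ∞) hV (by simp)).contDiffAt (hV.mem_nhds hx)).differentiableAt
      (by simp)
  have h2 : ∀ j k, tcov G b (tcov G b (fun y (_ : κ → ι) ↦ f y)) x (ocons j (ocons k I)) =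
      fderiv ℝ (fderiv ℝ f) x (b j) (b k) - fderiv ℝ f x (chrAt G x (b j) (b k)) := by
    intro j k
    rw [tcov_apply_ocons, Fintype.sum_option]
    simp only [Fintype.sum_empty, add_zero, h1, ocons_none, update_ocons_none]
    rw [fderiv_clm_apply_const hfd (b k) (b j), chrAt_basis_eq_sum b x j k, map_sum]
    simp only [map_smul, smul_eq_mul]
  rw [tlap_apply, lapAt_eq_sum G b]
  simp only [h2]

end More

/-! ### The Laplacian of `|T|²` -/

section LapNorm

variable [Fintype ι] {G : E → E →L[ℝ] E →L[ℝ] ℝ} {b : Basis ι ℝ E} {α : Type*} [Fintype α] [DecidableEq α]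
  {V : Set E} {x : E} [CompleteSpace E] [FiniteDimensional ℝ E]

/-- **`Δ|T|² = 2⟨ΔT, T⟩ + 2|∇T|²`** (Topping 2006, p. 37: "`d|Rm|² = 2⟨Rm, ∇Rm⟩` so
`Δ|Rm|² = 2|∇Rm|² + 2⟨Rm, ΔRm⟩`", here for a covariant tensor field of any rank; `Δ` on the
left is the coordinate Laplace–Beltrami operator `lapAt` of the scalar `|T|²`).
[cite: Topping2006, §3.2, p. 37] -/
theorem IsMetricOn.lapAt_tnormSq (hG : IsMetricOn G V) {T : E → (α → ι) → ℝ} (hT : TSmoothOn T V)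
    (hx : x ∈ V) :
    lapAt G (tnormSq G b T) x = 2 * tinner G b (tlap G b T) T x + 2 * tnormSq G b (tcov G b T) x := by
  have hgs : ∀ p q, ginv G b x p q = ginv G b x q p :=
    fun p q ↦ ginv_comm b (hG.isInvertible x hx) (hG.symm x hx) p q
  have hN : ContDiffOn ℝ ∞ (tnormSq G b T) V := hG.contDiffOn_tnormSq hT
  have hS : TSmoothOn (tcov G b T) V := hG.tsmoothOn_tcov hT
  have hn1 : ∀ y ∈ V, ∀ l, fderiv ℝ (tnormSq G b T) y (b l) = 2 * pcontr G b (tcov G b T) T y l :=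
    fun y hy l ↦ by rw [hG.fderiv_tnormSq hT hy l]; rfl
  have hNd : DifferentiableAt ℝ (fderiv ℝ (tnormSq G b T)) x :=
    ((hN.fderiv_of_isOpen (m := ∞) hG.isOpen (by simp)).contDiffAt
      (hG.isOpen.mem_nhds hx)).differentiableAt (by simp)
  have hPcd : ∀ k, DifferentiableAt ℝ (fun y ↦ pcontr G b (tcov G b T) T y k) x := fun k ↦
    ((hG.contDiffOn_pcontr hS hT k).contDiffAt (hG.isOpen.mem_nhds hx)).differentiableAt (by simp)
  have hn2 : ∀ j k, fderiv ℝ (fderiv ℝ (tnormSq G b T)) x (b j) (b k) =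
      2 * (pcontr G b (fun y J ↦ tcov G b (tcov G b T) y (ocons j J)) T x k
        + pcontr G b (tcov G b T) (fun y I ↦ tcov G b T y (ocons j I)) x k
        + ∑ m, chrCoef G b x j k m * pcontr G b (tcov G b T) T x m) := by
    intro j k
    rw [← fderiv_clm_apply_const hNd (b k) (b j)]
    have hev : (fun y ↦ fderiv ℝ (tnormSq G b T) y (b k)) =ᶠ[𝓝 x]
        fun y ↦ 2 * pcontr G b (tcov G b T) T y k :=
      Filter.eventually_of_mem (hG.isOpen.mem_nhds hx) fun y hy ↦ hn1 y hy k
    rw [hev.fderiv_eq, fderiv_const_mul (hPcd k) 2, _root_.smul_apply, smul_eq_mul,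
      hG.fderiv_pcontr hS hT hx j k]
  have hn3 : ∀ j k, fderiv ℝ (tnormSq G b T) x (chrAt G x (b j) (b k)) =
      2 * ∑ m, chrCoef G b x j k m * pcontr G b (tcov G b T) T x m := by
    intro j k
    rw [chrAt_basis_eq_sum b x j k, map_sum, Finset.mul_sum]
    refine Finset.sum_congr rfl fun m _ ↦ ?_
    rw [map_smul, smul_eq_mul, hn1 x hx]
    ring
  have hA : ∑ j, ∑ k, ginv G b x j k *
      pcontr G b (fun y J ↦ tcov G b (tcov G b T) y (ocons j J)) T x k = tinner G b (tlap G b T) T x := by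
    simp only [pcontr_apply, tinner_apply, tlap_apply, Finset.mul_sum, Finset.sum_mul]
    rw [sum_comm₂₂ fun (j k : ι) (I J : α → ι) ↦ ginv G b x j k *
      ((∏ a, ginv G b x (I a) (J a)) * (tcov G b (tcov G b T) x (ocons j (ocons k I)) * T x J))]
    exact Finset.sum_congr rfl fun I _ ↦ Finset.sum_congr rfl fun J _ ↦
      Finset.sum_congr rfl fun j _ ↦ Finset.sum_congr rfl fun k _ ↦ by ring
  have hB : ∑ j, ∑ k, ginv G b x j k *
      pcontr G b (tcov G b T) (fun y I ↦ tcov G b T y (ocons j I)) x k = tnormSq G b (tcov G b T) x := by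
    rw [tnormSq_eq, tinner_option, Finset.sum_comm]
    refine Finset.sum_congr rfl fun k _ ↦ Finset.sum_congr rfl fun j _ ↦ ?_
    rw [pcontr_apply, hgs j k]
  rw [lapAt_eq_sum G b]
  simp only [hn2, hn3]
  calc ∑ j, ∑ k, ginv G b x j k *
        (2 * (pcontr G b (fun y J ↦ tcov G b (tcov G b T) y (ocons j J)) T x k
          + pcontr G b (tcov G b T) (fun y I ↦ tcov G b T y (ocons j I)) x k
          + ∑ m, chrCoef G b x j k m * pcontr G b (tcov G b T) T x m)
          - 2 * ∑ m, chrCoef G b x j k m * pcontr G b (tcov G b T) T x m)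
      = ∑ j, ∑ k, (2 * (ginv G b x j k *
            pcontr G b (fun y J ↦ tcov G b (tcov G b T) y (ocons j J)) T x k)
          + 2 * (ginv G b x j k *
            pcontr G b (tcov G b T) (fun y I ↦ tcov G b T y (ocons j I)) x k)) :=
        Finset.sum_congr rfl fun j _ ↦ Finset.sum_congr rfl fun k _ ↦ by ring
    _ = 2 * ∑ j, ∑ k, ginv G b x j k *
            pcontr G b (fun y J ↦ tcov G b (tcov G b T) y (ocons j J)) T x k
        + 2 * ∑ j, ∑ k, ginv G b x j k *
            pcontr G b (tcov G b T) (fun y I ↦ tcov G b T y (ocons j I)) x k := by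
        simp only [Finset.sum_add_distrib, Finset.mul_sum]
    _ = _ := by rw [hA, hB]

end LapNorm

end MetricCoord

end Literature.Geometry.Lorentzian

end
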